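import Summits.Ventures.PercRepro.Night2FatXGenericTwelveA

/-!
# night-2: generic off-points close `|G| = 12` — and hence EVERY `|G|`

At `N = 6` (`m = 5` points of `W ∖ {x}`) the levels `1, 4, 5, 6` are unloaded with generic off-points and give
`175.7/221`; the missing `0.205` comes from the levels `2, 3`: a free point `y` gives the level-2 target `Q ∪ {x, y}`
(`110/221 · 1/5`) and four unloaded level-3 targets through `x, y` (`4 · (180/221)/15`, total `1.112`); all of
`W ∖ {x}` on one basis line leaves nothing loaded (`fat_count_sum_ge_one_of_unloaded`); otherwise the lighter of two
basis lines gives four unloaded level-3 targets (`four_le_unloaded_level_three_sum`) and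
`110/221 + 4 · (180/221)/15 + 10 · (180/221)/35 + 5 · (180/221)/70 + (180/221)/126 = 223.7/221 > 1`.
**`basis_pair_fair_fat_of_generic_six`**, **`localShadowHall_fat_of_generic_of_card_eq_twelve`**, and the assembly
**`localShadowHall_fat_of_generic`**: THE (2,1) CELL WITH A FAT CLOSURE AND GENERIC OFF-POINTS (no three-point line of
`V` coplanar with the two points of `G ∖ clF B₀`) SATISFIES THE LOCAL HALL INEQUALITY FOR EVERY `|G|`
(`|G| ≤ 11`: `localShadowHall_fat_of_generic_of_card_le_eleven`; `12`: this module; `13`: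
`localShadowHall_fat_of_generic_of_card_eq_thirteen`; `≥ 14`: `localShadowHall_fat_of_generic_of_fourteen_le`).
Paper `proofs/NIGHT-2-g33.md` §6 (f).
-/

namespace PercRepro.Shadow

open PercRepro.ThmH PercRepro.PerFlat

variable {α : Type*} [DecidableEq α] {M : Matroid α} [M.Finite] {G : Finset α}

/-- **The fat case of (FAIR) with generic off-points at `N = 6`.** -/
theorem basis_pair_fair_fat_of_generic_six (hG : G ∈ flatsQ M (5 + 1)) (hd : (gr M \ G).card = 2)
    (hk : kColoops M G = 1) (hs : ∀ e ∈ gr M, ∀ f ∈ gr M, e ≠ f → rkN M {e, f} = 2)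
    (hl : ∀ e ∈ gr M, M.Indep {e}) (hfat : (fatClosures M 5 G 2).card ≤ 1)
    {B₀ : Finset α} (hB₀ : B₀ ∈ thinMembers M 5 G) {w₀ x : α} (hD : G \ clF M B₀ = {w₀, x}) (hne : w₀ ≠ x)
    (hgen : ∀ R ⊆ G \ coloops M G, rkN M R = 2 → 3 ≤ R.card → 4 ≤ rkN M (insert w₀ (insert x R)))
    {B : Finset α} (hB : B ∈ thinMembers M 5 G) (hnP : ¬ bigP M G B) {z : α} (hz : z ∈ G \ clF M B)
    (hl0 : loss M 5 G B z ≠ 0) (hw₀ : w₀ ∈ insert z B) (hx : x ∉ insert z B) (hN : (G \ insert z B).card = 6) :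
    loss M 5 G B z ≤ rhoL M 5 G B z * lossIncomeH M 5 G (bigP M G) (dshGT2 M 5 G) B z := by
  have hGg : G ⊆ gr M := (mem_flatsQ.1 hG).1
  have hd' : (gr M \ G).card ≤ 5 := by omega
  have hQG : insert z B ⊆ G :=
    Finset.insert_subset (Finset.mem_sdiff.1 hz).1 (subset_G_of_mem_thinMembers hB)
  have hxG : x ∈ G \ insert z B := by
    refine Finset.mem_sdiff.2 ⟨?_, hx⟩
    have : x ∈ G \ clF M B₀ := by
      rw [hD]
      exact Finset.mem_insert_of_mem (Finset.mem_singleton_self _)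
    exact (Finset.mem_sdiff.1 this).1
  set W' := (G \ insert z B).erase x with hW'
  have hm : W'.card + 1 = (G \ insert z B).card := by
    rw [hW', Finset.card_erase_of_mem hxG]
    omega
  -- the common part: levels `1, 4, 5, 6`
  have htop : ∀ T ∈ tgtSets M 5 G B z, x ∈ T → 4 ≤ (T \ insert z B).card →
      dload M 5 G (bigP M G) (dshGT2 M 5 G) T = 0 := by
    intro T hT _ h4
    have hTG : T ⊆ G := subset_G_of_mem_shadowAt (mem_tgtSets.1 hT).1
    have hGT := card_sdiff_add_card_sdiff_of_mem_tgtSets hT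
    exact dload_eq_zero_of_card_sdiff_le_two_of_generic hG hd hk hs hl hfat hB₀ hD hgen hTG (by omega)
  have hl1 := fat_count_level_ge' hG hd hk hB hnP hz hxG (j := 1) (by norm_num)
    (fun T hT _ h1 => dload_eq_zero_of_card_sdiff_le_six hG hd hk hs hl
      (by rw [card_sdiff_coloops_eq_level_add_five hG hd hk hB hnP hz hT, h1]))
  have hl4 := fat_count_level_ge' hG hd hk hB hnP hz hxG (j := 4) (by norm_num)
    (fun T hT hxT h4 => htop T hT hxT (by omega))
  have hl5 := fat_count_level_ge' hG hd hk hB hnP hz hxG (j := 5) (by norm_num)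
    (fun T hT hxT h5 => htop T hT hxT (by omega))
  have hl6 := fat_count_level_ge' hG hd hk hB hnP hz hxG (j := 6) (by norm_num)
    (fun T hT hxT h6 => htop T hT hxT (by omega))
  rw [hN] at hl1 hl4 hl5 hl6
  have hg0 : ∀ T ∈ (tgtSets M 5 G B z).filter
      (fun T => x ∈ T ∧ dload M 5 G (bigP M G) (dshGT2 M 5 G) T = 0),
      0 ≤ capS M 5 G T / ((221 / 360 : ℚ) * ((2 * ((T \ coloops M G).card - 2).choose 4 : ℕ) : ℚ)) :=
    fun T _ => div_nonneg (capS_nonneg' hG hd' T) (by positivity)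
  apply basis_pair_fair_of_fat_count_sum hG hd hk hs hl hfat hB₀ hD hne hB hnP hz hl0 hw₀ hx
  by_cases hfree : ∃ y ∈ W', ∀ a ∈ (insert z B \ coloops M G).erase w₀,
      ∀ b ∈ (insert z B \ coloops M G).erase w₀, a ≠ b → rkN M {a, b, y} = 3
  · -- a free point: the levels `2, 3` through `x, y`
    obtain ⟨y, hy, hfr⟩ := hfree
    have hyG : y ∈ G \ insert z B := Finset.mem_of_mem_erase hy
    have hxy : x ≠ y := fun h' => (Finset.mem_erase.1 hy).1 h'.symm
    have hload : ∀ T ∈ tgtSets M 5 G B z, x ∈ T → y ∈ T → dload M 5 G (bigP M G) (dshGT2 M 5 G) T = 0 :=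
      fun _ hT hxT hyT => dload_eq_zero_of_free_of_generic hG hd hk hs hl hfat hB₀ hD hgen hB hnP hz hx hyG hxy
        hfr hT hxT hyT
    have hsum := sum_levels_le_sum hg0 (fun T => (T \ insert z B).card) {1, 2, 3, 4, 5, 6}
    rw [Finset.sum_insert (by decide), Finset.sum_insert (by decide), Finset.sum_insert (by decide),
      Finset.sum_insert (by decide), Finset.sum_insert (by decide), Finset.sum_singleton] at hsum
    have hl2 := fat_count_level_ge_pair hG hd hk hB hnP hz hxG hyG hxy (j := 2) (by norm_num)
      (fun T hT hxT hyT _ => hload T hT hxT hyT)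
    have hl3 := fat_count_level_ge_pair hG hd hk hB hnP hz hxG hyG hxy (j := 3) (by norm_num)
      (fun T hT hxT hyT _ => hload T hT hxT hyT)
    rw [hN] at hl2 hl3
    have hnum : (1 : ℚ) ≤ (((6 - 1).choose (1 - 1) : ℕ) : ℚ) * fatTerm 1 (if 6 - 1 ≤ 3 then 1 else 11 / 18) +
        ((((6 - 2).choose (2 - 2) : ℕ) : ℚ) * fatTerm 2 (if 6 - 2 ≤ 3 then 1 else 11 / 18) +
        (((6 - 2).choose (3 - 2) : ℕ) : ℚ) * fatTerm 3 (if 6 - 3 ≤ 3 then 1 else 11 / 18) +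
        (((6 - 1).choose (4 - 1) : ℕ) : ℚ) * fatTerm 4 (if 6 - 4 ≤ 3 then 1 else 11 / 18) +
        (((6 - 1).choose (5 - 1) : ℕ) : ℚ) * fatTerm 5 (if 6 - 5 ≤ 3 then 1 else 11 / 18) +
        (((6 - 1).choose (6 - 1) : ℕ) : ℚ) * fatTerm 6 (if 6 - 6 ≤ 3 then 1 else 11 / 18)) := by
      unfold fatTerm
      norm_num [Nat.choose]
    linarith
  · have hall : ∀ y ∈ W', ∃ a ∈ (insert z B \ coloops M G).erase w₀, ∃ b ∈ (insert z B \ coloops M G).erase w₀,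
        a ≠ b ∧ rkN M {a, b, y} ≤ 2 := by
      intro y hy
      by_contra hcon
      apply hfree
      refine ⟨y, hy, ?_⟩
      intro a ha b hb hab
      have h3 : rkN M {a, b, y} ≤ 3 := le_trans (rkN_le_card _) Finset.card_le_three
      by_contra hne3
      exact hcon ⟨a, ha, b, hb, hab, by omega⟩
    obtain ⟨y₀, hy₀⟩ : W'.Nonempty := by
      rw [← Finset.card_pos]
      omega
    obtain ⟨a₀, ha₀, b₀, hb₀, hab₀, hl₀⟩ := hall y₀ hy₀
    set L₀ := W'.filter (fun y => rkN M (insert y {a₀, b₀}) ≤ 2) with hL₀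
    have hy₀L : y₀ ∈ L₀ := by
      rw [hL₀, Finset.mem_filter, insert_pair_eq']
      exact ⟨hy₀, hl₀⟩
    by_cases hcol : ∀ y ∈ W', rkN M (insert y {a₀, b₀}) ≤ 2
    · have ha₀G : a₀ ∈ G := hQG (Finset.mem_sdiff.1 (Finset.mem_of_mem_erase ha₀)).1
      have hb₀G : b₀ ∈ G := hQG (Finset.mem_sdiff.1 (Finset.mem_of_mem_erase hb₀)).1
      have hsub : W' ⊆ clF M {a₀, b₀} := by
        intro y hy
        have h' := hcol y hy
        rw [insert_pair_eq'] at h'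
        exact mem_clF_pair_of_rkN_le_two hG hs ha₀G hb₀G (Finset.mem_sdiff.1 (Finset.mem_of_mem_erase hy)).1
          hab₀.symm h'
      have hrk : rkN M W' ≤ 2 := by
        have := rkN_mono (M := M) hsub
        rw [rkN_clF, hs a₀ (hGg ha₀G) b₀ (hGg hb₀G) hab₀] at this
        exact this
      -- nothing is loaded: use the unloaded theorem's sum
      exact fat_count_sum_ge_one_of_unloaded hG hd hk hB hnP hz hxG
        (fun T hT hxT => dload_eq_zero_of_collinear_of_generic hG hd hk hs hl hfat hB₀ hD hgen hrk hT hxT)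
    · obtain ⟨y', hy'W, hy'L⟩ : ∃ y' ∈ W', ¬ rkN M (insert y' {a₀, b₀}) ≤ 2 := by
        by_contra hcon
        apply hcol
        intro y hy
        by_contra h'
        exact hcon ⟨y, hy, h'⟩
      obtain ⟨a', ha', b', hb', hab', hl'⟩ := hall y' hy'W
      set L' := W'.filter (fun y => rkN M (insert y {a', b'}) ≤ 2) with hL'
      have hy'L' : y' ∈ L' := by
        rw [hL', Finset.mem_filter, insert_pair_eq']
        exact ⟨hy'W, hl'⟩
      have hpairs : ({a₀, b₀} : Finset α) ≠ {a', b'} := by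
        intro heq
        apply hy'L
        rw [heq, insert_pair_eq']
        exact hl'
      have hdisj : Disjoint L₀ L' := by
        rw [Finset.disjoint_left]
        intro y hyL₀ hyL'
        rw [hL₀, Finset.mem_filter, insert_pair_eq'] at hyL₀
        rw [hL', Finset.mem_filter, insert_pair_eq'] at hyL'
        exact not_on_two_basis_lines hG hd hk hs hl hB hnP hz (Finset.mem_of_mem_erase ha₀)
          (Finset.mem_of_mem_erase hb₀) (Finset.mem_of_mem_erase ha') (Finset.mem_of_mem_erase hb') hab₀ hab'
          hpairs (Finset.mem_of_mem_erase hyL₀.1) hyL₀.2 hyL'.2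
      have hcards : L₀.card + L'.card ≤ W'.card := by
        rw [← Finset.card_union_of_disjoint hdisj]
        exact Finset.card_le_card (Finset.union_subset (Finset.filter_subset _ _) (Finset.filter_subset _ _))
      have hy₀L' : ¬ rkN M (insert y₀ {a', b'}) ≤ 2 := by
        intro h'
        have : y₀ ∈ L' := by
          rw [hL', Finset.mem_filter]
          exact ⟨hy₀, h'⟩
        exact Finset.disjoint_left.1 hdisj hy₀L this
      have hsum := sum_levels_le_sum hg0 (fun T => (T \ insert z B).card) {1, 3, 4, 5, 6}
      rw [Finset.sum_insert (by decide), Finset.sum_insert (by decide), Finset.sum_insert (by decide),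
        Finset.sum_insert (by decide), Finset.sum_singleton] at hsum
      have hnum : (1 : ℚ) ≤ (((6 - 1).choose (1 - 1) : ℕ) : ℚ) * fatTerm 1 (if 6 - 1 ≤ 3 then 1 else 11 / 18) +
          (4 * fatTerm 3 1 +
          (((6 - 1).choose (4 - 1) : ℕ) : ℚ) * fatTerm 4 (if 6 - 4 ≤ 3 then 1 else 11 / 18) +
          (((6 - 1).choose (5 - 1) : ℕ) : ℚ) * fatTerm 5 (if 6 - 5 ≤ 3 then 1 else 11 / 18) +
          (((6 - 1).choose (6 - 1) : ℕ) : ℚ) * fatTerm 6 (if 6 - 6 ≤ 3 then 1 else 11 / 18)) := by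
        unfold fatTerm
        norm_num [Nat.choose]
      rcases Nat.lt_or_ge L₀.card 3 with h₀ | h₀
      · have hl3 := four_le_unloaded_level_three_sum hG hd hk hs hl hfat hB₀ hD hgen hB hnP hz hxG hN hy₀ ha₀ hb₀
          hab₀ hl₀ (by rw [← hW', ← hL₀]; omega) hy'W hy'L
        linarith
      · have hL'2 : L'.card ≤ 2 := by omega
        have hl3 := four_le_unloaded_level_three_sum hG hd hk hs hl hfat hB₀ hD hgen hB hnP hz hxG hN hy'W ha' hb'
          hab' hl' (by rw [← hW', ← hL']; omega) hy₀ hy₀L'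
        linarith

/-- **The (2,1) cell with a fat closure and generic off-points, `|G| = 12`.** -/
theorem localShadowHall_fat_of_generic_of_card_eq_twelve (hG : G ∈ flatsQ M (5 + 1))
    (hd : (gr M \ G).card = 2) (hk : kColoops M G = 1)
    (hs : ∀ e ∈ gr M, ∀ f ∈ gr M, e ≠ f → rkN M {e, f} = 2) (hl : ∀ e ∈ gr M, M.Indep {e})
    (hfat : (fatClosures M 5 G 2).card ≤ 1) {B₀ : Finset α} (hB₀ : B₀ ∈ thinMembers M 5 G)
    (hm₀ : (G \ clF M B₀).card = 2)
    (hgen : ∀ R ⊆ G \ coloops M G, rkN M R = 2 → 3 ≤ R.card → 4 ≤ rkN M (R ∪ (G \ clF M B₀)))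
    (hG12 : G.card = 12) : LocalShadowHall M 5 G := by
  apply localShadowHall_of_gt2_of_basis_fair hG hd hk hs hl hfat
  intro B hB hnP z hz
  have hd' : (gr M \ G).card ≤ 5 := by omega
  by_cases hl0 : loss M 5 G B z = 0
  · rw [hl0]
    have h1 : 0 ≤ rhoL M 5 G B z := by
      unfold rhoL
      rw [hl0]
      simp
    have h2 : 0 ≤ lossIncomeH M 5 G (bigP M G) (dshGT2 M 5 G) B z :=
      lossIncomeH_nonneg hG hd' (column_side_gt2 hG hd hk hs hl hfat) B z
    positivity
  · obtain ⟨w₀, x, hD, hne, hw₀, hx⟩ := exists_fat_split hG hd hk hB₀ hm₀ hB hz hl0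
    have hgen' : ∀ R ⊆ G \ coloops M G, rkN M R = 2 → 3 ≤ R.card → 4 ≤ rkN M (insert w₀ (insert x R)) := by
      intro R hR hR2 hR3
      have := hgen R hR hR2 hR3
      rw [hD] at this
      have heq : R ∪ ({w₀, x} : Finset α) = insert w₀ (insert x R) := by
        ext e
        simp only [Finset.mem_union, Finset.mem_insert, Finset.mem_singleton]
        tauto
      rw [heq] at this
      exact this
    have hN : (G \ insert z B).card = 6 := by
      have hQG : insert z B ⊆ G :=
        Finset.insert_subset (Finset.mem_sdiff.1 hz).1 (subset_G_of_mem_thinMembers hB)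
      have hKQ : coloops M G ⊆ insert z B :=
        (coloops_subset_of_mem_thinMembers hG hd' hB).trans (Finset.subset_insert _ _)
      have hQ5 := card_insert_sdiff_eq_five hG hd hk hB hnP hz
      have h1 := Finset.card_sdiff_add_card_eq_card hKQ
      rw [← kColoops_eq_card_coloops, hk, hQ5] at h1
      have h2 := Finset.card_sdiff_add_card_eq_card hQG
      omega
    exact basis_pair_fair_fat_of_generic_six hG hd hk hs hl hfat hB₀ hD hne hgen' hB hnP hz hl0 hw₀ hx hN

/-- **THE (2,1) CELL WITH A FAT CLOSURE AND GENERIC OFF-POINTS SATISFIES THE LOCAL HALL INEQUALITY FOR EVERY `|G|`.** -/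
theorem localShadowHall_fat_of_generic (hG : G ∈ flatsQ M (5 + 1)) (hd : (gr M \ G).card = 2)
    (hk : kColoops M G = 1) (hs : ∀ e ∈ gr M, ∀ f ∈ gr M, e ≠ f → rkN M {e, f} = 2)
    (hl : ∀ e ∈ gr M, M.Indep {e}) (hfat : (fatClosures M 5 G 2).card ≤ 1)
    {B₀ : Finset α} (hB₀ : B₀ ∈ thinMembers M 5 G) (hm₀ : (G \ clF M B₀).card = 2)
    (hgen : ∀ R ⊆ G \ coloops M G, rkN M R = 2 → 3 ≤ R.card → 4 ≤ rkN M (R ∪ (G \ clF M B₀))) :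
    LocalShadowHall M 5 G := by
  rcases Nat.lt_or_ge G.card 12 with h12 | h12
  · exact localShadowHall_fat_of_generic_of_card_le_eleven hG hd hk hs hl hfat hB₀ hm₀ hgen (by omega)
  · rcases Nat.lt_or_ge G.card 13 with h13 | h13
    · exact localShadowHall_fat_of_generic_of_card_eq_twelve hG hd hk hs hl hfat hB₀ hm₀ hgen (by omega)
    · rcases Nat.lt_or_ge G.card 14 with h14 | h14
      · exact localShadowHall_fat_of_generic_of_card_eq_thirteen hG hd hk hs hl hfat hB₀ hm₀ hgen (by omega)
      · exact localShadowHall_fat_of_generic_of_fourteen_le hG hd hk hs hl hfat hB₀ hm₀ hgen h14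

end PercRepro.Shadow
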